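/-
Copyright (c) 2026 the pub-hodgecm-mathlib formalisation cell (harness21).  Prover seat hodgecm-mathlib-LH4-p13 (g0): Track A «(D-RAM) FOUR-FRAME» squad of crux H413
(dealer LH4-plan (g10) WORD #29 «p13 → (e) `stub_U2H_typeTwoRow_wild`»), 2026-09-03.
-/
import Mathlib.Combinatorics.SimpleGraph.Acyclic
import Mathlib.Combinatorics.SimpleGraph.Connectivity.Subgraph
import Mathlib.Data.Set.Card
import HarnessLib

/-!
# The fixed subtree of a tree automorphism: colour-preserving with a fixed vertex ⇒ the fixed vertices form a finite SUBTREE and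
# `#{set-wise fixed edges} + 1 = #{fixed vertices}` (Serre, *Trees* I §2.3, §6.1; Kottwitz 1988 §2 «the fixed points form a subtree»)

Topic `Combinatorics/SimpleGraph`; namespace `Literature.Combinatorics.SimpleGraph.TreeAutomorphism`.  THEOREMS ONLY (no definition, no instance, no notation, no named fact,
no `sorry`); pure Mathlib graph theory.  Cell `pub/hodgecm-mathlib` (D-0151), crux H413 = `stmt-HodgeConjecture-24833`, Track A «(D-RAM) FOUR-FRAME», unit U2H (ii-H), child (e)
`stub_U2H_typeTwoRow_wild`: the combinatorial heart of «#Fix_{γ₂}(U₂ ⧸ K_vertex) = #Fix_{γ₂}(U₂ ⧸ K_edge) + 1» for a deep element at ANY ramified place (the wild replacement of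
the `|2|_w = 1`-guarded ★ `natCard_fixedBy_add_one_eq_natCard_fixedBy_of_deep_of_ramified`; consumers: ★ p847070 ∕ ★ p855177 ∕ ★ p855231 ∕ ★ p855331, which read the two
coset counts as fixed VERTICES resp. set-wise fixed EDGES of the tree of `SL₂(L⁺_v)`).  HONEST LABEL: HC_CM is proved only modulo the 7 printed citations (2 remaining named
inputs: hLiu418 = stmt-HodgeConjecture-24832, h413 = stmt-HodgeConjecture-24833) until rung 0 closes; nothing printed is asserted here.

THE MATHEMATICS.  `X` a tree, `φ : X →g X` an injective graph endomorphism preserving a PROPER 2-COLOURING `T` (`a ~ b ⇒ (T a ↔ ¬ T b)`, `T (φ a) ↔ T a` — for the tree of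
`SL₂` the colouring «self-dual ∕ modular» of the lattice vertices, preserved by every element of determinant valuation zero), fixing a vertex `x₀`.  (1) The unique path from
`x₀` to a fixed vertex is mapped to a path with the same endpoints, hence to itself: every vertex on it is fixed (`forall_mem_support_eq_of_isAcyclic`).  (2) `φ` inverts no
edge: an inverted edge `{a, b}` would give `T a ↔ T (φ a) = T b ↔ ¬ T a`.  Hence an edge is fixed SET-WISE iff both its endpoints are fixed (`sym2Map_eq_iff_of_adj`).  (3) The
fixed vertex set `S` is therefore path-closed and contains `x₀`, so the induced graph `X[S]` is connected (patching the paths of (1)) and acyclic, a TREE; when `S` is finite,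
`#E(X[S]) + 1 = #S` (Mathlib `isTree_iff_connected_and_card`), and `E(X[S])` is in bijection with the set-wise fixed edges of `X` by (2): **`#{e | φ·e = e} + 1 = #{x | φ x = x}`**
(`ncard_fixedEdges_add_one_eq_ncard_fixedVerts`).

* §1 private `forall_eq_of_map_eq` (lists), `forall_mem_support_eq_of_isAcyclic`, `sym2Map_eq_iff_of_adj`.
* §2 `isTree_induce_fixedVerts`, **`ncard_fixedEdges_add_one_eq_ncard_fixedVerts`**.
* §3 `iff_iff_even_length` (a proper `2`-colouring alternates along walks), `iff_map_of_connected` (an endomorphism of a CONNECTED graph fixing a vertex preserves every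
  proper `2`-colouring — so `hφT` of §2 is automatic), `ncard_fixedEdges_add_one_eq_ncard_fixedVerts_of_connected` (§2's head without `hφT`),
  **`ncard_fixedEdges_add_one_eq_ncard_fixedVerts_of_isTree`** (§2's head with NO colouring hypothesis: a tree is `2`-colourable, Mathlib `IsTree.coloringTwoOfVert`).

## References
* [Serre1980Trees] J.-P. Serre, *Trees* (1980), Ch. I §2.3 (trees: unique geodesics), §6.1 (fixed points), Ch. II §1.1.
* [Kottwitz1988] R. E. Kottwitz, *Tamagawa numbers*, Ann. of Math. 127 (1988), §2 (the fixed points of an elliptic element form a subtree; Euler–Poincaré).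
* [Diestel2010] R. Diestel, *Graph Theory*, 4th ed., GTM 173 (2010), Prop. 1.6.1 (proof: the bipartition of a connected graph is the parity of the distance from a root).
-/

set_option autoImplicit false

namespace Literature.Combinatorics.SimpleGraph.TreeAutomorphism

open _root_.SimpleGraph

variable {W : Type*} {X : SimpleGraph W}

/-! ## §1 Paths are fixed pointwise; no edge is inverted -/

/-- A list fixed by `map f` is fixed pointwise. [folklore] -/
private theorem forall_eq_of_map_eq {α : Type*} {f : α → α} : ∀ {l : List α}, l.map f = l → ∀ x ∈ l, f x = x
  | [], _, x, hx => absurd hx List.not_mem_nil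
  | a :: t, h, x, hx => by
    rw [List.map_cons, List.cons.injEq] at h
    rcases List.mem_cons.1 hx with rfl | hx
    · exact h.1
    · exact forall_eq_of_map_eq h.2 x hx

/-- **THE PATH BETWEEN TWO FIXED VERTICES IS FIXED POINTWISE**: in an acyclic graph, an injective endomorphism `φ` fixing `a` and `b` fixes every vertex of a path from `a`
to `b` (the image path has the same endpoints, hence equals it). [cite: Serre1980Trees, Ch. I §2.3] -/
theorem forall_mem_support_eq_of_isAcyclic (hX : X.IsAcyclic) (φ : X →g X) (hinj : Function.Injective φ)
    {a b : W} (ha : φ a = a) (hb : φ b = b) {p : X.Walk a b} (hp : p.IsPath) : ∀ c ∈ p.support, φ c = c := by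
  have hq : ((p.map φ).copy ha hb).IsPath := by
    rw [Walk.isPath_copy]
    exact (Walk.isPath_map_iff_of_injective hinj).2 hp
  have heq : (p.map φ).copy ha hb = p := congrArg Subtype.val (hX.path_unique ⟨_, hq⟩ ⟨p, hp⟩)
  have hsup : ((p.map φ).copy ha hb).support = p.support := by rw [heq]
  rw [Walk.support_copy, Walk.support_map] at hsup
  exact forall_eq_of_map_eq hsup

/-- **NO INVERSIONS**: if `φ` preserves a proper `2`-colouring `T` of the edge `{a, b}`, then `φ` fixes the edge SET-WISE iff it fixes BOTH endpoints.
[cite: Serre1980Trees, Ch. I §6.1] -/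
theorem sym2Map_eq_iff_of_adj (φ : W → W) {T : W → Prop} (hφT : ∀ a, T (φ a) ↔ T a) {a b : W} (hT : T a ↔ ¬ T b) :
    Sym2.map φ s(a, b) = s(a, b) ↔ φ a = a ∧ φ b = b := by
  rw [Sym2.map_mk, Sym2.eq_iff]
  constructor
  · rintro (h | ⟨h1, h2⟩)
    · exact h
    · exfalso
      have h3 : T b ↔ T a := by have h := hφT a; rw [h1] at h; exact h
      exact iff_not_self (h3.trans hT)
  · rintro ⟨h1, h2⟩
    exact Or.inl ⟨h1, h2⟩

/-! ## §2 The fixed vertices induce a subtree; the count -/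

/-- **THE FIXED VERTICES OF A COLOUR-PRESERVING INJECTIVE ENDOMORPHISM OF A TREE FIXING A VERTEX INDUCE A TREE** (connected: the path from the fixed base vertex to a
fixed vertex is fixed pointwise, §1; acyclic: induced subgraphs of acyclic graphs are acyclic). [cite: Serre1980Trees, Ch. I §6.1] [cite: Kottwitz1988, §2] -/
theorem isTree_induce_fixedVerts (hX : X.IsTree) (φ : X →g X) (hinj : Function.Injective φ) {x₀ : W} (hx₀ : φ x₀ = x₀) :
    (X.induce {x | φ x = x}).IsTree := by
  refine ⟨?_, hX.isAcyclic.induce _⟩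
  refine induce_connected_of_patches x₀ hx₀ fun {a} ha => ?_
  obtain ⟨p, hp⟩ := hX.connected.exists_isPath x₀ a
  refine ⟨{c | c ∈ p.support}, fun c hc => forall_mem_support_eq_of_isAcyclic hX.isAcyclic φ hinj hx₀ ha hp c hc,
    p.start_mem_support, p.end_mem_support, ?_⟩
  exact (p.connected_induce_support) _ _

/-- **`#{set-wise fixed edges} + 1 = #{fixed vertices}`** for an injective endomorphism `φ` of a tree `X` preserving a proper `2`-colouring `T` and fixing a vertex `x₀`, whenever
the fixed vertex set is finite: the set-wise fixed edges are exactly the edges of the fixed SUBTREE (§1: no inversions), and a finite tree has one more vertex than edges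
(Mathlib `isTree_iff_connected_and_card`).  `Set.ncard` on both sides. [cite: Serre1980Trees, Ch. I §2.3, §6.1] [cite: Kottwitz1988, §2] -/
theorem ncard_fixedEdges_add_one_eq_ncard_fixedVerts (hX : X.IsTree) (φ : X →g X) (hinj : Function.Injective φ)
    {T : W → Prop} (hT : ∀ ⦃a b : W⦄, X.Adj a b → (T a ↔ ¬ T b)) (hφT : ∀ a, T (φ a) ↔ T a)
    {x₀ : W} (hx₀ : φ x₀ = x₀) (hfin : {x | φ x = x}.Finite) :
    {e : X.edgeSet | Sym2.map φ (e : Sym2 W) = e}.ncard + 1 = {x | φ x = x}.ncard := by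
  classical
  haveI : Finite {x | φ x = x} := hfin.to_subtype
  -- the fixed subtree and its vertex ∕ edge count
  have hT' := isTree_induce_fixedVerts hX φ hinj hx₀
  have hcard : Nat.card (X.induce {x | φ x = x}).edgeSet + 1 = Nat.card {x | φ x = x} :=
    ((isTree_iff_connected_and_card).1 hT').2
  -- the edges of `X[S]` are the set-wise fixed edges of `X`
  have hE : Nat.card (X.induce {x | φ x = x}).edgeSet = Nat.card {e : X.edgeSet | Sym2.map φ (e : Sym2 W) = e} := by
    refine Nat.card_congr (Equiv.ofBijective
      (fun e => ⟨⟨Sym2.map (Subtype.val : {x | φ x = x} → W) e.1, ?_⟩, ?_⟩) ⟨?_, ?_⟩)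
    · -- an edge of the induced graph is an edge of `X`
      obtain ⟨e, he⟩ := e
      induction e using Sym2.ind with
      | h a b => rw [Sym2.map_mk, SimpleGraph.mem_edgeSet]; exact (SimpleGraph.mem_edgeSet _).1 he
    · -- and it is fixed set-wise (both endpoints are fixed)
      obtain ⟨e, he⟩ := e
      induction e using Sym2.ind with
      | h a b =>
        show Sym2.map φ (Sym2.map Subtype.val s(a, b)) = Sym2.map Subtype.val s(a, b)
        rw [Sym2.map_mk, Sym2.map_mk, a.2, b.2]
    · -- injective
      rintro ⟨e, he⟩ ⟨e', he'⟩ h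
      have h' : Sym2.map (Subtype.val : {x | φ x = x} → W) e = Sym2.map Subtype.val e' :=
        congrArg (fun z : {e : X.edgeSet | Sym2.map φ (e : Sym2 W) = e} => ((z : X.edgeSet) : Sym2 W)) h
      exact Subtype.ext (Sym2.map.injective Subtype.val_injective h')
    · -- surjective: a set-wise fixed edge has both endpoints fixed
      rintro ⟨⟨e, hmem⟩, hfix⟩
      induction e using Sym2.ind with
      | h a b =>
        have hab : X.Adj a b := (SimpleGraph.mem_edgeSet _).1 hmem
        have hfix' : Sym2.map φ s(a, b) = s(a, b) := hfix
        obtain ⟨ha, hb⟩ := (sym2Map_eq_iff_of_adj φ hφT (hT hab)).1 hfix'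
        exact ⟨⟨s(⟨a, ha⟩, ⟨b, hb⟩), (SimpleGraph.mem_edgeSet _).2 hab⟩, rfl⟩
  rw [← Nat.card_coe_set_eq, ← Nat.card_coe_set_eq, ← hE]
  exact hcard

/-! ## §3 The colouring hypothesis `hφT` is automatic for a connected graph with a fixed vertex -/

/-- **A PROPER `2`-COLOURING ALTERNATES ALONG WALKS**: if adjacent vertices have opposite colours, then along any walk `p` from `a` to `b` one has `(T a ↔ T b) ↔ Even p.length`
(the bipartition of a connected graph is the parity of the distance from a root). [cite: Diestel2010, Prop. 1.6.1 (proof)] -/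
theorem iff_iff_even_length {T : W → Prop} (hT : ∀ ⦃a b : W⦄, X.Adj a b → (T a ↔ ¬ T b)) :
    ∀ {a b : W} (p : X.Walk a b), ((T a ↔ T b) ↔ Even p.length)
  | _, _, Walk.nil => by simp
  | _, _, Walk.cons h q => by
    have hq := iff_iff_even_length hT q
    have hab := hT h
    rw [Walk.length_cons, Nat.even_add_one, ← hq]
    tauto

/-- **AN ENDOMORPHISM OF A CONNECTED GRAPH FIXING A VERTEX PRESERVES EVERY PROPER `2`-COLOURING**: `T (φ a) ↔ T a` for all `a` — compare the parities of a walk `x₀ ⟶ a` and of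
its image `x₀ = φ x₀ ⟶ φ a`, which have the same length (§3 `iff_iff_even_length`).  No injectivity and no acyclicity needed. [cite: Diestel2010, Prop. 1.6.1 (proof)]
[cite: Serre1980Trees, Ch. I §6.1] -/
theorem iff_map_of_connected (hconn : X.Connected) (φ : X →g X) {T : W → Prop} (hT : ∀ ⦃a b : W⦄, X.Adj a b → (T a ↔ ¬ T b))
    {x₀ : W} (hx₀ : φ x₀ = x₀) (a : W) : T (φ a) ↔ T a := by
  obtain ⟨p⟩ := hconn x₀ a
  have h1 := iff_iff_even_length hT p
  have h2 := iff_iff_even_length hT (p.map φ)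
  rw [Walk.length_map, hx₀] at h2
  tauto

/-- **`#{set-wise fixed edges} + 1 = #{fixed vertices}` WITHOUT THE COLOUR-PRESERVATION HYPOTHESIS**: for an injective endomorphism `φ` of a tree `X` fixing a vertex `x₀`, with
finite fixed vertex set, and ANY proper `2`-colouring `T` of `X` (a tree has one: the parity of the distance from `x₀`), `φ` preserves `T` automatically (§3 `iff_map_of_connected`),
so §2 `ncard_fixedEdges_add_one_eq_ncard_fixedVerts` applies. [cite: Serre1980Trees, Ch. I §2.3, §6.1] [cite: Kottwitz1988, §2] [cite: Diestel2010, Prop. 1.6.1 (proof)] -/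
theorem ncard_fixedEdges_add_one_eq_ncard_fixedVerts_of_connected (hX : X.IsTree) (φ : X →g X) (hinj : Function.Injective φ)
    {T : W → Prop} (hT : ∀ ⦃a b : W⦄, X.Adj a b → (T a ↔ ¬ T b)) {x₀ : W} (hx₀ : φ x₀ = x₀) (hfin : {x | φ x = x}.Finite) :
    {e : X.edgeSet | Sym2.map φ (e : Sym2 W) = e}.ncard + 1 = {x | φ x = x}.ncard :=
  ncard_fixedEdges_add_one_eq_ncard_fixedVerts hX φ hinj hT (iff_map_of_connected hX.connected φ hT hx₀) hx₀ hfin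

/-- **`#{set-wise fixed edges} + 1 = #{fixed vertices}` FOR ANY INJECTIVE ENDOMORPHISM OF A TREE FIXING A VERTEX** (finite fixed vertex set; no colouring hypothesis at all):
a tree carries the proper `2`-colouring «parity of the distance from `x₀`» (Mathlib `IsTree.coloringTwoOfVert`), which `φ` preserves (§3 `iff_map_of_connected`); so there are no
inversions and §2 applies.  This is the form used downstream (the tree of `SL₂`, Serre Ch. II §1). [cite: Serre1980Trees, Ch. I §2.3, §6.1] [cite: Kottwitz1988, §2]
[cite: Diestel2010, Prop. 1.6.1 (proof)] -/
theorem ncard_fixedEdges_add_one_eq_ncard_fixedVerts_of_isTree (hX : X.IsTree) (φ : X →g X) (hinj : Function.Injective φ)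
    {x₀ : W} (hx₀ : φ x₀ = x₀) (hfin : {x | φ x = x}.Finite) :
    {e : X.edgeSet | Sym2.map φ (e : Sym2 W) = e}.ncard + 1 = {x | φ x = x}.ncard := by
  refine ncard_fixedEdges_add_one_eq_ncard_fixedVerts_of_connected hX φ hinj (T := fun a => hX.coloringTwoOfVert x₀ a = 0)
    (fun a b hab => ?_) hx₀ hfin
  have h : hX.coloringTwoOfVert x₀ a ≠ hX.coloringTwoOfVert x₀ b := (hX.coloringTwoOfVert x₀).valid hab
  revert h
  generalize hX.coloringTwoOfVert x₀ a = i
  generalize hX.coloringTwoOfVert x₀ b = j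
  intro h
  fin_cases i <;> fin_cases j <;> simp_all

end Literature.Combinatorics.SimpleGraph.TreeAutomorphism
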